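import Mathlib
import Literature.MathematicalPhysics.StatisticalMechanics.BarlowStacking
import Summits.AtomisticToContinuum.Crystallization.Theorems.GappedShellCensusCleanLimitsHaveWindowsLaminarBox2

/-!
# Laminar clean box: consecutive layers of a gapped-twelve laminar set are `3a/4 … 43a/50` apart and every
# registry slip is within `a/5` of a hollow site

The registered stub `laminar_clean_box` (laminar split, line `Sketch`) of the crux
`GappedShellCensus.CleanLimitsHaveWindows` (stmt-AtomisticToContinuum-15932): the geometric box on which the
energy certificate of `LaminarPinning` works. A laminar set is `Z = v₀ + A {i u + j v + w m + z m • e₃}` — every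
layer a translate of one planar near-triangular lattice `ℤu + ℤv` (`‖u‖, ‖v‖, ‖u - v‖ ∈ [0.98a, 1.02a]`),
horizontal slips `w m`, increasing heights `z m`. If `Z` is gapped-twelve at scale `a` (every site has exactly
twelve other points within `1.02a`, none closer than `0.98a`), then for every `m`:
`3a/4 ≤ z (m+1) - z m ≤ 43a/50`, and the slip `w (m+1) - w m` is within `a/5` of `-(I u + J v + (δ/3)(u + v))`
for some integers `I, J` and `δ ∈ {1, 2}`.

Proof (parts 1–2 in `…LaminarBox1/2`): work on indices `t = (m, i, j)` (the isometry `A` and `v₀` drop out).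
(1) Covering radius² `≤ 9a²/25` of the lattice + separation `0.98a` ⇒ `(z(m+1) - z m)² ≥ 1501a²/2500`, so layers
two apart are out of reach. (2) In the own layer only the six short translates are within reach (every other
lattice vector has squared norm `≥ 69a²/25`). (3) Two shell indices in the same adjacent layer are lattice
neighbours (both offsets lie in a disc of squared radius `11a²/25`), so an adjacent layer carries `≤ 3` of them
(the hexagon graph is triangle-free) and the count `12 ≤ 6 + #above + 3` leaves `≥ 3` above: a unit lattice
triangle whose vertices are all at squared horizontal distance `∈ [0.98²a² - h², 1.02²a² - h²]` from `-d`,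
`d = w(m+1) - w m`. (4) The three-disc lemma gives `h² ≤ 1.02²a² - 0.98²a²/3 ≤ (43a/50)²` and
`‖-d - centroid‖ ≤ a/5`; the centroid of a unit triangle is a hollow site `I u + J v + (δ/3)(u + v)`.
Only the separation half of the gap clause is used (the window `(1.02a, 1.26a)` is not needed).
-/

noncomputable section

namespace Summit.AtomisticToContinuum.Crystallization.Theorems.CleanHull

open Literature.MathematicalPhysics.StatisticalMechanics

/-! ## The layers of an index shell -/

/-- Horizontal reach of a shell index: `‖offset‖² ≤ (a(1 + 1/50))² - (height difference)²`. [folklore] -/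
theorem lcb_reach {a : ℝ} {u v : EuclideanSpace ℝ (Fin 3)} {w : ℤ → EuclideanSpace ℝ (Fin 3)} {z : ℤ → ℝ}
    (hu2 : u 2 = 0) (hv2 : v 2 = 0) (hw2 : ∀ m : ℤ, w m 2 = 0) {t₀ t : ℤ × ℤ × ℤ}
    (ht : t ∈ lcbS a u v w z t₀) :
    ‖lcbOff u v w t₀ t‖ ^ 2 ≤ (a * (1 + 1 / 50)) ^ 2 - (z t.1 - z t₀.1) ^ 2 := by
  have hsq := pow_le_pow_left₀ dist_nonneg ht.2 2
  rw [lcb_distSq hu2 hv2 hw2] at hsq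
  linarith

/-- **Only the own layer and the two adjacent layers are within reach.** [folklore] -/
theorem lcb_layer_trichotomy {a : ℝ} {u v : EuclideanSpace ℝ (Fin 3)} {w : ℤ → EuclideanSpace ℝ (Fin 3)}
    {z : ℤ → ℝ} (ha : 0 < a) (hu2 : u 2 = 0) (hv2 : v 2 = 0) (hw2 : ∀ m : ℤ, w m 2 = 0)
    (hzm : StrictMono z) (hincr : ∀ k : ℤ, 3 / 4 * a ≤ z (k + 1) - z k) {t₀ t : ℤ × ℤ × ℤ}
    (ht : t ∈ lcbS a u v w z t₀) : t.1 = t₀.1 ∨ t.1 = t₀.1 + 1 ∨ t.1 = t₀.1 - 1 := by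
  by_contra hc
  simp only [not_or] at hc
  have h2 : t₀.1 + 2 ≤ t.1 ∨ t.1 + 2 ≤ t₀.1 := by omega
  have hfar := lcb_far ha hzm hincr h2
  have hr := lcb_reach hu2 hv2 hw2 ht
  nlinarith [sq_nonneg ‖lcbOff u v w t₀ t‖]

/-- **In the own layer the shell indices are the six short translates.** [folklore] -/
theorem lcb_sameLayer_hex {a : ℝ} {u v : EuclideanSpace ℝ (Fin 3)} {w : ℤ → EuclideanSpace ℝ (Fin 3)}
    {z : ℤ → ℝ} (ha : 0 < a)
    (hu : a * (1 - 1 / 50) ≤ ‖u‖ ∧ ‖u‖ ≤ a * (1 + 1 / 50))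
    (hv : a * (1 - 1 / 50) ≤ ‖v‖ ∧ ‖v‖ ≤ a * (1 + 1 / 50))
    (huv : a * (1 - 1 / 50) ≤ ‖u - v‖ ∧ ‖u - v‖ ≤ a * (1 + 1 / 50))
    (hu2 : u 2 = 0) (hv2 : v 2 = 0) (hw2 : ∀ m : ℤ, w m 2 = 0) {t₀ t : ℤ × ℤ × ℤ}
    (ht : t ∈ lcbS a u v w z t₀) (hl : t.1 = t₀.1) : (t.2.1 - t₀.2.1, t.2.2 - t₀.2.2) ∈ bpHex := by
  have hr := lcb_reach hu2 hv2 hw2 ht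
  rw [lcbOff_sameLayer u v w hl.symm, hl, sub_self, zero_pow two_ne_zero, sub_zero] at hr
  have hlt : ‖((t.2.1 - t₀.2.1 : ℤ) : ℝ) • u + ((t.2.2 - t₀.2.2 : ℤ) : ℝ) • v‖ ^ 2 < 69 / 25 * a ^ 2 := by
    nlinarith [pow_pos ha 2]
  rcases lcb_lat_near ha hu hv huv hlt with h0 | h
  · exfalso
    simp only [Prod.mk.injEq] at h0
    exact ht.1 (Prod.ext hl (Prod.ext (by omega) (by omega)))
  · exact h

/-- **Two shell indices in the same adjacent layer are lattice neighbours**: both horizontal offsets are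
within `√(11/25) a` of the same point, so their difference is a lattice vector of squared norm `≤ 44a²/25`,
hence short. [folklore] -/
theorem lcb_adjacent {a : ℝ} {u v : EuclideanSpace ℝ (Fin 3)} {w : ℤ → EuclideanSpace ℝ (Fin 3)}
    {z : ℤ → ℝ} (ha : 0 < a)
    (hu : a * (1 - 1 / 50) ≤ ‖u‖ ∧ ‖u‖ ≤ a * (1 + 1 / 50))
    (hv : a * (1 - 1 / 50) ≤ ‖v‖ ∧ ‖v‖ ≤ a * (1 + 1 / 50))
    (huv : a * (1 - 1 / 50) ≤ ‖u - v‖ ∧ ‖u - v‖ ≤ a * (1 + 1 / 50))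
    (hu2 : u 2 = 0) (hv2 : v 2 = 0) (hw2 : ∀ m : ℤ, w m 2 = 0) {t₀ t t' : ℤ × ℤ × ℤ}
    (ht : t ∈ lcbS a u v w z t₀) (ht' : t' ∈ lcbS a u v w z t₀) (hl : t.1 = t'.1) (hne : t ≠ t')
    (hh : 1501 / 2500 * a ^ 2 ≤ (z t.1 - z t₀.1) ^ 2) :
    (t'.2.1 - t.2.1, t'.2.2 - t.2.2) ∈ bpHex := by
  have hr := lcb_reach hu2 hv2 hw2 ht
  have hr' := lcb_reach hu2 hv2 hw2 ht'
  rw [← hl] at hr'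
  have e : lcbOff u v w t₀ t' - lcbOff u v w t₀ t =
      ((t'.2.1 - t.2.1 : ℤ) : ℝ) • u + ((t'.2.2 - t.2.2 : ℤ) : ℝ) • v := by
    simp only [lcbOff, hl]
    push_cast
    module
  have htri := norm_sub_le (lcbOff u v w t₀ t') (lcbOff u v w t₀ t)
  rw [e] at htri
  have hsq : ‖((t'.2.1 - t.2.1 : ℤ) : ℝ) • u + ((t'.2.2 - t.2.2 : ℤ) : ℝ) • v‖ ^ 2 ≤
      (‖lcbOff u v w t₀ t'‖ + ‖lcbOff u v w t₀ t‖) ^ 2 := pow_le_pow_left₀ (norm_nonneg _) htri 2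
  have hlt : ‖((t'.2.1 - t.2.1 : ℤ) : ℝ) • u + ((t'.2.2 - t.2.2 : ℤ) : ℝ) • v‖ ^ 2 < 69 / 25 * a ^ 2 := by
    nlinarith [sq_nonneg (‖lcbOff u v w t₀ t'‖ - ‖lcbOff u v w t₀ t‖), norm_nonneg (lcbOff u v w t₀ t'),
      norm_nonneg (lcbOff u v w t₀ t)]
  rcases lcb_lat_near ha hu hv huv hlt with h0 | h
  · exfalso
    simp only [Prod.mk.injEq] at h0
    exact hne (Prod.ext hl (Prod.ext (by omega) (by omega)))
  · exact h

/-- **At most three shell indices in an adjacent layer** (they are pairwise lattice neighbours, and the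
triangular lattice has no four pairwise adjacent points). [folklore] -/
theorem lcb_layer_le_three {a : ℝ} {u v : EuclideanSpace ℝ (Fin 3)} {w : ℤ → EuclideanSpace ℝ (Fin 3)}
    {z : ℤ → ℝ} (ha : 0 < a)
    (hu : a * (1 - 1 / 50) ≤ ‖u‖ ∧ ‖u‖ ≤ a * (1 + 1 / 50))
    (hv : a * (1 - 1 / 50) ≤ ‖v‖ ∧ ‖v‖ ≤ a * (1 + 1 / 50))
    (huv : a * (1 - 1 / 50) ≤ ‖u - v‖ ∧ ‖u - v‖ ≤ a * (1 + 1 / 50))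
    (hu2 : u 2 = 0) (hv2 : v 2 = 0) (hw2 : ∀ m : ℤ, w m 2 = 0) {t₀ : ℤ × ℤ × ℤ} {ℓ : ℤ}
    (hh : 1501 / 2500 * a ^ 2 ≤ (z ℓ - z t₀.1) ^ 2) :
    {t | t ∈ lcbS a u v w z t₀ ∧ t.1 = ℓ}.ncard ≤ 3 := by
  by_contra hc
  have hc' : 3 < {t | t ∈ lcbS a u v w z t₀ ∧ t.1 = ℓ}.ncard := not_le.1 hc
  have hfin : {t | t ∈ lcbS a u v w z t₀ ∧ t.1 = ℓ}.Finite := Set.finite_of_ncard_pos (by omega)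
  obtain ⟨t₁, t₂, t₃, t₄, h₁, h₂, h₃, h₄, h12, h13, h14, h23, h24, h34⟩ := (Set.three_lt_ncard_iff hfin).1 hc'
  have adj : ∀ {t t' : ℤ × ℤ × ℤ}, t ∈ {t | t ∈ lcbS a u v w z t₀ ∧ t.1 = ℓ} →
      t' ∈ {t | t ∈ lcbS a u v w z t₀ ∧ t.1 = ℓ} → t ≠ t' → (t'.2.1 - t.2.1, t'.2.2 - t.2.2) ∈ bpHex := by
    intro t t' ht ht' hne
    refine lcb_adjacent ha hu hv huv hu2 hv2 hw2 ht.1 ht'.1 (ht.2.trans ht'.2.symm) hne ?_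
    rw [ht.2]; exact hh
  have e12 := adj h₁ h₂ h12
  have e13 := adj h₁ h₃ h13
  have e14 := adj h₁ h₄ h14
  have e23 := adj h₂ h₃ h23
  have e24 := adj h₂ h₄ h24
  have e34 := adj h₃ h₄ h34
  refine lcb_hex_no_triangle _ e12 _ e13 _ e14 ?_ ?_ ?_
  · simpa [Prod.mk_sub_mk, sub_sub_sub_cancel_right] using e23
  · simpa [Prod.mk_sub_mk, sub_sub_sub_cancel_right] using e24
  · simpa [Prod.mk_sub_mk, sub_sub_sub_cancel_right] using e34

/-- **The shell is covered by the six own-layer translates and the two adjacent layers.** [folklore] -/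
theorem lcb_shell_subset {a : ℝ} {u v : EuclideanSpace ℝ (Fin 3)} {w : ℤ → EuclideanSpace ℝ (Fin 3)}
    {z : ℤ → ℝ} (ha : 0 < a)
    (hu : a * (1 - 1 / 50) ≤ ‖u‖ ∧ ‖u‖ ≤ a * (1 + 1 / 50))
    (hv : a * (1 - 1 / 50) ≤ ‖v‖ ∧ ‖v‖ ≤ a * (1 + 1 / 50))
    (huv : a * (1 - 1 / 50) ≤ ‖u - v‖ ∧ ‖u - v‖ ≤ a * (1 + 1 / 50))
    (hu2 : u 2 = 0) (hv2 : v 2 = 0) (hw2 : ∀ m : ℤ, w m 2 = 0)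
    (hzm : StrictMono z) (hincr : ∀ k : ℤ, 3 / 4 * a ≤ z (k + 1) - z k) (t₀ : ℤ × ℤ × ℤ) :
    lcbS a u v w z t₀ ⊆
      ((fun e : ℤ × ℤ => (t₀.1, t₀.2.1 + e.1, t₀.2.2 + e.2)) '' (↑bpHex : Set (ℤ × ℤ)) ∪
        {t | t ∈ lcbS a u v w z t₀ ∧ t.1 = t₀.1 + 1}) ∪ {t | t ∈ lcbS a u v w z t₀ ∧ t.1 = t₀.1 - 1} := by
  intro t ht
  rcases lcb_layer_trichotomy ha hu2 hv2 hw2 hzm hincr ht with h | h | h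
  · left; left
    refine ⟨(t.2.1 - t₀.2.1, t.2.2 - t₀.2.2), lcb_sameLayer_hex ha hu hv huv hu2 hv2 hw2 ht h, ?_⟩
    exact Prod.ext h.symm (Prod.ext (by simp) (by simp))
  · left; right; exact ⟨ht, h⟩
  · right; exact ⟨ht, h⟩

/-- **At least three shell indices in the layer above** (`12 ≤ 6 + #above + 3`). [folklore] -/
theorem lcb_three_above {a : ℝ} {u v : EuclideanSpace ℝ (Fin 3)} {w : ℤ → EuclideanSpace ℝ (Fin 3)}
    {z : ℤ → ℝ} (ha : 0 < a)
    (hu : a * (1 - 1 / 50) ≤ ‖u‖ ∧ ‖u‖ ≤ a * (1 + 1 / 50))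
    (hv : a * (1 - 1 / 50) ≤ ‖v‖ ∧ ‖v‖ ≤ a * (1 + 1 / 50))
    (huv : a * (1 - 1 / 50) ≤ ‖u - v‖ ∧ ‖u - v‖ ≤ a * (1 + 1 / 50))
    (hu2 : u 2 = 0) (hv2 : v 2 = 0) (hw2 : ∀ m : ℤ, w m 2 = 0)
    (hz : ∀ m : ℤ, z m < z (m + 1)) (hhsq : ∀ k : ℤ, 1501 / 2500 * a ^ 2 ≤ (z (k + 1) - z k) ^ 2)
    (hcountI : ∀ t₀ : ℤ × ℤ × ℤ, (lcbS a u v w z t₀).ncard = 12) (t₀ : ℤ × ℤ × ℤ) :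
    2 < {t | t ∈ lcbS a u v w z t₀ ∧ t.1 = t₀.1 + 1}.ncard := by
  have hzm : StrictMono z := strictMono_int_of_lt_succ hz
  have hincr : ∀ k : ℤ, 3 / 4 * a ≤ z (k + 1) - z k := fun k => lcb_height_lower ha hz (hhsq k)
  have hsub := lcb_shell_subset ha hu hv huv hu2 hv2 hw2 hzm hincr t₀
  have hSfin : (lcbS a u v w z t₀).Finite := Set.finite_of_ncard_pos (by rw [hcountI t₀]; norm_num)
  have hfinU : {t | t ∈ lcbS a u v w z t₀ ∧ t.1 = t₀.1 + 1}.Finite := hSfin.subset fun t ht => ht.1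
  have hfinD : {t | t ∈ lcbS a u v w z t₀ ∧ t.1 = t₀.1 - 1}.Finite := hSfin.subset fun t ht => ht.1
  have hfinH : ((fun e : ℤ × ℤ => (t₀.1, t₀.2.1 + e.1, t₀.2.2 + e.2)) '' (↑bpHex : Set (ℤ × ℤ))).Finite :=
    (Finset.finite_toSet _).image _
  have h1 := Set.ncard_le_ncard hsub ((hfinH.union hfinU).union hfinD)
  have h2 := Set.ncard_union_le
    ((fun e : ℤ × ℤ => (t₀.1, t₀.2.1 + e.1, t₀.2.2 + e.2)) '' (↑bpHex : Set (ℤ × ℤ)) ∪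
      {t | t ∈ lcbS a u v w z t₀ ∧ t.1 = t₀.1 + 1}) {t | t ∈ lcbS a u v w z t₀ ∧ t.1 = t₀.1 - 1}
  have h3 := Set.ncard_union_le
    ((fun e : ℤ × ℤ => (t₀.1, t₀.2.1 + e.1, t₀.2.2 + e.2)) '' (↑bpHex : Set (ℤ × ℤ)))
      {t | t ∈ lcbS a u v w z t₀ ∧ t.1 = t₀.1 + 1}
  have h4 : ((fun e : ℤ × ℤ => (t₀.1, t₀.2.1 + e.1, t₀.2.2 + e.2)) '' (↑bpHex : Set (ℤ × ℤ))).ncard ≤ 6 := by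
    refine (Set.ncard_image_le (Finset.finite_toSet _)).trans ?_
    rw [Set.ncard_coe_finset, card_bpHex]
  have h5 : {t | t ∈ lcbS a u v w z t₀ ∧ t.1 = t₀.1 - 1}.ncard ≤ 3 := by
    refine lcb_layer_le_three ha hu hv huv hu2 hv2 hw2 ?_
    have e : (z (t₀.1 - 1) - z t₀.1) ^ 2 = (z (t₀.1 - 1 + 1) - z (t₀.1 - 1)) ^ 2 := by
      rw [sub_add_cancel]; ring
    rw [e]; exact hhsq _
  have h12 := hcountI t₀
  omega

/-! ## The box: heights and registry -/

/-- Arithmetic of the upper height bound. [folklore] -/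
theorem lcb_height_upper_arith {a h : ℝ} (ha : 0 < a) (h0 : 0 < h)
    (hle : (a * (1 - 1 / 50)) ^ 2 / 3 ≤ (a * (1 + 1 / 50)) ^ 2 - h ^ 2) : h ≤ 43 / 50 * a := by
  nlinarith [sq_nonneg (h + 43 / 50 * a), mul_pos h0 ha]

/-- **The laminar box on indices.** Under the index-level count and separation, consecutive heights differ by
`∈ [3a/4, 43a/50]` and every registry slip `w (m+1) - w m` is within `a/5` of a hollow site
`-(I u + J v + (δ/3)(u + v))`, `δ ∈ {1, 2}`. [folklore] -/
theorem lcb_box_index {a : ℝ} {u v : EuclideanSpace ℝ (Fin 3)} {w : ℤ → EuclideanSpace ℝ (Fin 3)}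
    {z : ℤ → ℝ} (ha : 0 < a)
    (hu : a * (1 - 1 / 50) ≤ ‖u‖ ∧ ‖u‖ ≤ a * (1 + 1 / 50))
    (hv : a * (1 - 1 / 50) ≤ ‖v‖ ∧ ‖v‖ ≤ a * (1 + 1 / 50))
    (huv : a * (1 - 1 / 50) ≤ ‖u - v‖ ∧ ‖u - v‖ ≤ a * (1 + 1 / 50))
    (hu2 : u 2 = 0) (hv2 : v 2 = 0) (hw2 : ∀ m : ℤ, w m 2 = 0) (hz : ∀ m : ℤ, z m < z (m + 1))
    (hcountI : ∀ t₀ : ℤ × ℤ × ℤ, (lcbS a u v w z t₀).ncard = 12)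
    (hgapI : ∀ t t' : ℤ × ℤ × ℤ, t ≠ t' → a * (1 - 1 / 50) ≤ dist (lcbPt u v w z t) (lcbPt u v w z t'))
    (m : ℤ) :
    (3 / 4 * a ≤ z (m + 1) - z m ∧ z (m + 1) - z m ≤ 43 / 50 * a) ∧
      ∃ i j : ℤ, ‖(w (m + 1) - w m) + ((i : ℝ) • u + (j : ℝ) • v + (1 / 3 : ℝ) • (u + v))‖ ≤ a / 5 ∨
        ‖(w (m + 1) - w m) + ((i : ℝ) • u + (j : ℝ) • v + (2 / 3 : ℝ) • (u + v))‖ ≤ a / 5 := by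
  have hhsq : ∀ k : ℤ, 1501 / 2500 * a ^ 2 ≤ (z (k + 1) - z k) ^ 2 :=
    lcb_height_sq_lower ha hu hv huv hu2 hv2 hw2 hgapI
  have hlow : 3 / 4 * a ≤ z (m + 1) - z m := lcb_height_lower ha hz (hhsq m)
  have h0 : 0 < z (m + 1) - z m := sub_pos.2 (hz m)
  -- three indices above `(m, 0, 0)`
  set t₀ : ℤ × ℤ × ℤ := (m, 0, 0) with ht₀
  have hSfin : (lcbS a u v w z t₀).Finite := Set.finite_of_ncard_pos (by rw [hcountI t₀]; norm_num)
  have hfinU : {t | t ∈ lcbS a u v w z t₀ ∧ t.1 = t₀.1 + 1}.Finite := hSfin.subset fun t ht => ht.1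
  obtain ⟨t₁, t₂, t₃, h₁, h₂, h₃, h12, h13, h23⟩ := (Set.two_lt_ncard_iff hfinU).1
    (lcb_three_above ha hu hv huv hu2 hv2 hw2 hz hhsq hcountI t₀)
  -- notation
  set d : EuclideanSpace ℝ (Fin 3) := w (m + 1) - w m with hd
  set h : ℝ := z (m + 1) - z m with hh
  have hd2 : d 2 = 0 := by simp [hd, hw2]
  -- the horizontal offsets of the indices above
  have hoff : ∀ {t : ℤ × ℤ × ℤ}, t ∈ {t | t ∈ lcbS a u v w z t₀ ∧ t.1 = t₀.1 + 1} →
      lcbOff u v w t₀ t = ((t.2.1 : ℝ) • u + (t.2.2 : ℝ) • v) + d ∧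
      (a * (1 - 1 / 50)) ^ 2 - h ^ 2 ≤ ‖-d - ((t.2.1 : ℝ) • u + (t.2.2 : ℝ) • v)‖ ^ 2 ∧
      ‖-d - ((t.2.1 : ℝ) • u + (t.2.2 : ℝ) • v)‖ ^ 2 ≤ (a * (1 + 1 / 50)) ^ 2 - h ^ 2 := by
    intro t ht
    have hl : t.1 = m + 1 := ht.2
    have e : lcbOff u v w t₀ t = ((t.2.1 : ℝ) • u + (t.2.2 : ℝ) • v) + d := by
      simp only [lcbOff, ht₀, hl, sub_zero, hd]
    have en : ‖-d - ((t.2.1 : ℝ) • u + (t.2.2 : ℝ) • v)‖ = ‖lcbOff u v w t₀ t‖ := by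
      rw [e, ← norm_neg]; congr 1; abel
    have hzz : (z t.1 - z t₀.1) ^ 2 = h ^ 2 := by rw [hl, hh]
    have hup := lcb_reach hu2 hv2 hw2 ht.1
    have hlo := pow_le_pow_left₀ (by positivity) (hgapI t₀ t (fun h' => ht.1.1 h'.symm)) 2
    rw [lcb_distSq hu2 hv2 hw2, hzz] at hlo
    rw [hzz] at hup
    rw [en]
    exact ⟨e, by linarith, hup⟩
  obtain ⟨-, lo1, hi1⟩ := hoff h₁
  obtain ⟨-, lo2, hi2⟩ := hoff h₂
  obtain ⟨-, lo3, hi3⟩ := hoff h₃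
  -- pairwise adjacency
  have hhm : 1501 / 2500 * a ^ 2 ≤ (z (t₀.1 + 1) - z t₀.1) ^ 2 := hhsq _
  have adj : ∀ {t t' : ℤ × ℤ × ℤ}, t ∈ {t | t ∈ lcbS a u v w z t₀ ∧ t.1 = t₀.1 + 1} →
      t' ∈ {t | t ∈ lcbS a u v w z t₀ ∧ t.1 = t₀.1 + 1} → t ≠ t' →
      (t'.2.1 - t.2.1, t'.2.2 - t.2.2) ∈ bpHex := by
    intro t t' ht ht' hne
    refine lcb_adjacent ha hu hv huv hu2 hv2 hw2 ht.1 ht'.1 (ht.2.trans ht'.2.symm) hne ?_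
    rw [ht.2]; exact hhm
  -- sides of the triangle
  have side : ∀ {t t' : ℤ × ℤ × ℤ}, t ∈ {t | t ∈ lcbS a u v w z t₀ ∧ t.1 = t₀.1 + 1} →
      t' ∈ {t | t ∈ lcbS a u v w z t₀ ∧ t.1 = t₀.1 + 1} → t ≠ t' →
      (a * (1 - 1 / 50)) ^ 2 ≤ ‖((t.2.1 : ℝ) • u + (t.2.2 : ℝ) • v) - ((t'.2.1 : ℝ) • u + (t'.2.2 : ℝ) • v)‖ ^ 2 ∧
      ‖((t.2.1 : ℝ) • u + (t.2.2 : ℝ) • v) - ((t'.2.1 : ℝ) • u + (t'.2.2 : ℝ) • v)‖ ^ 2 ≤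
        (a * (1 + 1 / 50)) ^ 2 := by
    intro t t' ht ht' hne
    have hx := lcb_lat_hex hu hv huv (adj ht' ht hne.symm)
    have e : ((t.2.1 : ℝ) • u + (t.2.2 : ℝ) • v) - ((t'.2.1 : ℝ) • u + (t'.2.2 : ℝ) • v) =
        ((t.2.1 - t'.2.1 : ℤ) : ℝ) • u + ((t.2.2 - t'.2.2 : ℤ) : ℝ) • v := by
      push_cast; module
    rw [e]
    exact lcb_sq_bounds ha hx
  have s12 := side h₁ h₂ h12
  have s13 := side h₁ h₃ h13
  have s23 := side h₂ h₃ h23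
  -- the three-disc lemma
  have hA2 : ((t₁.2.1 : ℝ) • u + (t₁.2.2 : ℝ) • v) 2 = 0 := by simp [hu2, hv2]
  have hB2 : ((t₂.2.1 : ℝ) • u + (t₂.2.2 : ℝ) • v) 2 = 0 := by simp [hu2, hv2]
  have hC2 : ((t₃.2.1 : ℝ) • u + (t₃.2.2 : ℝ) • v) 2 = 0 := by simp [hu2, hv2]
  have hx2 : (-d) 2 = 0 := by simp [hd2]
  obtain ⟨hmean, hreg⟩ := lcb_three_disc ha hx2 hA2 hB2 hC2 s12 s13 s23 ⟨lo1, hi1⟩ ⟨lo2, hi2⟩ ⟨lo3, hi3⟩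
    (by linarith)
  refine ⟨⟨hlow, lcb_height_upper_arith ha h0 hmean⟩, ?_⟩
  -- the centroid is a hollow site
  have e12 := adj h₁ h₂ h12
  have e13 := adj h₁ h₃ h13
  have e23 := adj h₂ h₃ h23
  have e23' : (t₃.2.1 - t₁.2.1, t₃.2.2 - t₁.2.2) - (t₂.2.1 - t₁.2.1, t₂.2.2 - t₁.2.2) ∈ bpHex := by
    simpa [Prod.mk_sub_mk, sub_sub_sub_cancel_right] using e23
  obtain ⟨hmod, hδ⟩ := lcb_hex_pair_mod _ e12 _ e13 e23'
  simp only at hmod hδ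
  set δ : ℤ := (t₂.2.1 - t₁.2.1 + (t₃.2.1 - t₁.2.1)) % 3 with hδdef
  have hq1 : (t₂.2.1 - t₁.2.1) + (t₃.2.1 - t₁.2.1) = 3 * ((t₂.2.1 - t₁.2.1 + (t₃.2.1 - t₁.2.1)) / 3) + δ := by
    have := Int.mul_ediv_add_emod (t₂.2.1 - t₁.2.1 + (t₃.2.1 - t₁.2.1)) 3
    linarith
  have hq2 : (t₂.2.2 - t₁.2.2) + (t₃.2.2 - t₁.2.2) = 3 * ((t₂.2.2 - t₁.2.2 + (t₃.2.2 - t₁.2.2)) / 3) + δ := by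
    have := Int.mul_ediv_add_emod (t₂.2.2 - t₁.2.2 + (t₃.2.2 - t₁.2.2)) 3
    rw [hmod]
    linarith
  have hG := lcb_centroid_form u v hq1 hq2
  rw [hG] at hreg
  set I : ℤ := t₁.2.1 + (t₂.2.1 - t₁.2.1 + (t₃.2.1 - t₁.2.1)) / 3
  set J : ℤ := t₁.2.2 + (t₂.2.2 - t₁.2.2 + (t₃.2.2 - t₁.2.2)) / 3
  have hn : ‖d + ((I : ℝ) • u + (J : ℝ) • v + ((δ : ℝ) / 3) • (u + v))‖ ≤ a / 5 := by
    have e : ‖d + ((I : ℝ) • u + (J : ℝ) • v + ((δ : ℝ) / 3) • (u + v))‖ =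
        ‖-d - ((I : ℝ) • u + (J : ℝ) • v + ((δ : ℝ) / 3) • (u + v))‖ := by
      rw [← norm_neg]; congr 1; abel
    rw [e]
    refine (pow_le_pow_iff_left₀ (norm_nonneg _) (by positivity) two_ne_zero).1 ?_
    rw [show (a / 5) ^ 2 = a ^ 2 / 25 by ring]
    exact hreg
  refine ⟨I, J, ?_⟩
  rcases hδ with h1 | h2
  · left
    rw [h1] at hn
    simpa using hn
  · right
    rw [h2] at hn
    simpa using hn

/-- **Laminar clean box** (registered stub `laminar_clean_box` of the laminar split of
`GappedShellCensus.CleanLimitsHaveWindows`). In a laminar set `Z = v₀ + A {i u + j v + w m + z m • e₃}` that is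
gapped-twelve at scale `a`, consecutive layers are between `3a/4` and `43a/50` apart and each registry slip
`w (m+1) - w m` lies within `a/5` of a hollow site of the layer lattice (a coset `∓(u + v)/3 + ℤu + ℤv`).
[folklore] -/
theorem laminar_clean_box : ∀ (a : ℝ) (Z : Set (EuclideanSpace ℝ (Fin 3))) (A : EuclideanSpace ℝ (Fin 3) →ₗᵢ[ℝ] EuclideanSpace ℝ (Fin 3)) (u v : EuclideanSpace ℝ (Fin 3)) (w : ℤ → EuclideanSpace ℝ (Fin 3)) (z : ℤ → ℝ) (v₀ : EuclideanSpace ℝ (Fin 3)), 0 < a → (∀ y ∈ Z, {x ∈ Z | x ≠ y ∧ dist y x ≤ a * (1 + 1 / 50)}.ncard = 12 ∧ ∀ x ∈ Z, x ≠ y → a * (1 - 1 / 50) ≤ dist y x ∧ (dist y x ≤ a * (1 + 1 / 50) ∨ a * (63 / 50) ≤ dist y x)) → u 2 = 0 → v 2 = 0 → (∀ m : ℤ, w m 2 = 0) → (a * (1 - 1 / 50) ≤ ‖u‖ ∧ ‖u‖ ≤ a * (1 + 1 / 50)) → (a * (1 - 1 / 50) ≤ ‖v‖ ∧ ‖v‖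 ≤ a * (1 + 1 / 50)) → (a * (1 - 1 / 50) ≤ ‖u - v‖ ∧ ‖u - v‖ ≤ a * (1 + 1 / 50)) → (∀ m : ℤ, z m < z (m + 1)) → Z = (fun p => p + v₀) '' {p : EuclideanSpace ℝ (Fin 3) | ∃ m i j : ℤ, p = A (((i : ℝ) • u) + ((j : ℝ) • v) + w m + (z m • layerNormal 1))} → ∀ m : ℤ, (3 / 4 * a ≤ z (m + 1) - z m ∧ z (m + 1) - z m ≤ 43 / 50 * a) ∧ ∃ i j : ℤ, ‖(w (m + 1) - w m) + ((i : ℝ) • u + (j : ℝ) • v + (1 / 3 : ℝ) • (u + v))‖ ≤ a / 5 ∨ ‖(w (m + 1) - w m) + ((i : ℝ) • u + (j : ℝ) • v + (2 / 3 : ℝ) • (u + v))‖ ≤ a / 5 := by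
  intro a Z A u v w z v₀ ha hclean hu2 hv2 hw2 hu hv huv hz hZ m
  have hzm : StrictMono z := strictMono_int_of_lt_succ hz
  have hinj : Function.Injective (lcbPt u v w z) := lcb_pt_injective ha hu hv huv hu2 hv2 hw2 hzm
  have hcountI : ∀ t₀ : ℤ × ℤ × ℤ, (lcbS a u v w z t₀).ncard = 12 := fun t₀ =>
    lcb_countI hZ hinj (fun y hy => (hclean y hy).1) t₀
  have hgapI : ∀ t t' : ℤ × ℤ × ℤ, t ≠ t' → a * (1 - 1 / 50) ≤ dist (lcbPt u v w z t) (lcbPt u v w z t') :=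
    fun t t' hne => (lcb_gapI hZ hinj (fun y hy => (hclean y hy).2) hne).1
  exact lcb_box_index ha hu hv huv hu2 hv2 hw2 hz hcountI hgapI m

end Summit.AtomisticToContinuum.Crystallization.Theorems.CleanHull

end
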